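import Summits.KontsevichZagierPeriods.KontsevichZagierPeriods.Theorems.TerasomaMultiplicationBetaCancellationWeightDescent
import Summits.KontsevichZagierPeriods.KontsevichZagierPeriods.Theorems.TerasomaMultiplicationBetaCancellationStubBetaWeightSemialgebraic
import Summits.KontsevichZagierPeriods.KontsevichZagierPeriods.Theorems.TerasomaMultiplicationBetaCancellationStubBetaWeightPinned

/-!
# `BetaCancellation` HOLDS for every weight-compatible certificate — all positive rational exponents

Crux lead seat c9, cycle 2 (`--supports` stmt-KontsevichZagierPeriods-13633, line `dirichlet-companion-to-pi`).
A direct, unconditional partial result on the crux IN ITS OWN TERMS (no passage through `[π]`).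
The crux asks: for `q = β_{a,b} ⊗ r`, `q' = β_{a,b} ⊗ r'` pinned with the Beta kernel
`t^{a-1}(1-t)^{b-1}` in the first coordinate, does `q ∼ q'` force `r ∼ r'`? It is proved for
integer exponents (`Negative/IntegerExponents.lean`: polynomial primitive, one Newton–Leibniz move)
and open otherwise (≡ item 0540). The MULTIPLIER METHOD of `…WeightDescent.lean` reduces the
non-integer case to the integer one for every certificate compatible with ONE weight: put
`w_{a,b}(t) = t^{⌈a⌉-a}(1-t)^{⌈b⌉-b}` on `(0,1)` (and `0` outside) — bounded, `ℚ`-semialgebraic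
(rational powers); the multiplier `M_w [t, f] = [t, w(z 0)·f]` maps every certificate lying in the
closure of additivity, the `w`-PRESERVING substitutions (`w (Φ z 0) = w (z 0)`: they may fix the Beta
variable, or swap the two points of each level set of `w`, and act arbitrarily on the other
coordinates) and Newton–Leibniz over bases of dimension `≥ 1` into `relations` (`stub_weightMul`),
and `M_w q = [q.domain, t^{A}(1-t)^{B} f]` IS pinned with the INTEGER kernel `kerPoly A B`
(`stub_betaWeightPinned`), which the integer theorem cancels (`equivalent_scaledBase_of_isPinned`,
`of_sub_nsmul_scaledBase_mem`: the reciprocal integer `N = (A+B+1)!/(A!B!)` rides inside the integrand).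

* `betaCancellation_of_weightCompatible` — for ALL rationals `0 < a ≤ A+1`, `0 < b ≤ B+1`: if
  `[q] − [q']` lies in the `w_{a,b}`-compatible closure then `r ∼ r'`;
* `betaCancellation_of_fibredCertificate` — in particular for every FIBRED certificate
  (`KZ.fibredRelations`: the Beta variable treated as a parameter, `Φ z 0 = z 0`).

So a counterexample to the crux at non-integer `(a, b)` needs a substitution that moves the Beta
variable across the level sets of `t^{⌈a⌉-a}(1-t)^{⌈b⌉-b}` — the Beta-coordinate shadow of the
chord-crossing obstruction isolated for `[π]` by seats c7–c9.
-/

noncomputable section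

-- `Summit.KontsevichZagierPeriods.KontsevichZagierPeriods.…` is the tree's mandated layout (single-conjunct summit).
set_option linter.dupNamespace false

namespace Summit.KontsevichZagierPeriods.KontsevichZagierPeriods.BetaCancellationLine

open Set
open Literature.NumberTheory.Transcendental
open Literature.NumberTheory.Transcendental.KZ
open Summit.KontsevichZagierPeriods.KontsevichZagierPeriods.BetaCancellationNegative
  (pinDomain pinFun IsPinned kerPoly aeval_kerPoly scaledBase betaDenom
    equivalent_scaledBase_of_isPinned of_sub_nsmul_scaledBase_mem)

/-! ## Registered stubs — both delegated stubs are tree theorems (wave 2, seat c9)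

`stub_betaWeightSemialgebraic` (p125688, `…StubBetaWeightSemialgebraic.lean`) and `stub_betaWeightPinned`
(p125702, `…StubBetaWeightPinned.lean`), imported above. -/

/-! ## Assembly -/


/-- Transport of the multiplier's pinning clause to dimension `1 + n` (the crux indexes the Beta
coordinate as `Fin.castAdd n 0 : Fin (1 + n)`; the multiplier is pinned on `IntegralRep (k + 1)`
with the coordinate `0 : Fin (k + 1)`): `subst` along `1 + n = n + 1`. [folklore] -/
theorem weightMul_apply_of_dim_eq (w : ℝ → ℝ) (M : FormalRep →+ FormalRep)
    (hpin : ∀ (k : ℕ) (r s : IntegralRep (k + 1)), s.domain = r.domain →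
      (s.integrand = fun z => w (z 0) * r.integrand z) → M (of r) = of s)
    {N k : ℕ} (hN : N = k + 1) (i : Fin N) (hi : i.val = 0) (q s : IntegralRep N)
    (hsd : s.domain = q.domain) (hsi : s.integrand = fun z => w (z i) * q.integrand z) :
    M (of q) = of s := by
  subst hN
  obtain rfl : i = 0 := Fin.ext hi
  exact hpin k q s hsd hsi

/-- Transport of the existence of weighted companions to dimension `1 + n`. [folklore] -/
theorem weightExists_of_dim_eq (w : ℝ → ℝ)
    (hex : ∀ (k : ℕ) (r : IntegralRep (k + 1)),
      ∃ s : IntegralRep (k + 1), s.domain = r.domain ∧ s.integrand = fun z => w (z 0) * r.integrand z)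
    {N k : ℕ} (hN : N = k + 1) (i : Fin N) (hi : i.val = 0) (q : IntegralRep N) :
    ∃ s : IntegralRep N, s.domain = q.domain ∧ s.integrand = fun z => w (z i) * q.integrand z := by
  subst hN
  obtain rfl : i = 0 := Fin.ext hi
  exact hex k q

/-- **Integer-kernel cancellation, two-representation form**: if `s`, `s'` are pinned over `r`, `r'`
with the polynomial kernel `t^A (1-t)^B` and `[s] − [s'] ∈ relations`, then `r ∼ r'`
(`equivalent_scaledBase_of_isPinned` + `of_sub_nsmul_scaledBase_mem`: the reciprocal integer
`N = (A+B+1)!/(A!B!)` rides inside the integrand, no division). [folklore] -/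
theorem equivalent_of_isPinned_kerPoly {n m : ℕ} (A B : ℕ) {r : IntegralRep n} {r' : IntegralRep m}
    {s : IntegralRep (1 + n)} {s' : IntegralRep (1 + m)}
    (hs : IsPinned (fun t => (Polynomial.aeval t (kerPoly A B) : ℝ)) r s)
    (hs' : IsPinned (fun t => (Polynomial.aeval t (kerPoly A B) : ℝ)) r' s')
    (hss' : of s - of s' ∈ relations) : Equivalent r r' := by
  have hss : Equivalent (scaledBase r (kerPoly A B)) (scaledBase r' (kerPoly A B)) :=
    ((equivalent_scaledBase_of_isPinned hs).symm.trans hss').trans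
      (equivalent_scaledBase_of_isPinned hs')
  have h1 := of_sub_nsmul_scaledBase_mem r A B
  have h2 := of_sub_nsmul_scaledBase_mem r' A B
  have h3 : betaDenom A B • (of (scaledBase r (kerPoly A B)) - of (scaledBase r' (kerPoly A B))) ∈
      relations := relations.nsmul_mem hss _
  have : of r - of r' = (of r - betaDenom A B • of (scaledBase r (kerPoly A B))) +
      betaDenom A B • (of (scaledBase r (kerPoly A B)) - of (scaledBase r' (kerPoly A B))) -
      (of r' - betaDenom A B • of (scaledBase r' (kerPoly A B))) := by
    rw [nsmul_sub]; abel
  show of r - of r' ∈ relations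
  rw [this]
  exact relations.sub_mem (relations.add_mem h1 h3) h2

/-- **`BetaCancellation` FOR WEIGHT-COMPATIBLE CERTIFICATES — all positive rational exponents.**
Let `0 < a ≤ A + 1`, `0 < b ≤ B + 1` be rational and `w = w_{a,b}` the weight
`t^{A+1-a}(1-t)^{B+1-b}` on `(0,1)` (`0` outside). If `q`, `q'` are pinned over `r`, `r'` with the
Beta kernel `t^{a-1}(1-t)^{b-1}` (the crux's hypotheses, verbatim) and `[q] − [q']` lies in the
closure of additivity, the `w`-preserving changes of variables and Newton–Leibniz over bases of
dimension `≥ 1`, then `r ∼ r'`. Proof: the multiplier `M_w` (`exists_weightMul`, `stub_weightExists`)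
maps the certificate into `relations` (`stub_weightMul`) and `M_w q`, `M_w q'` are pinned with the
integer kernel `t^A (1-t)^B` (`stub_betaWeightPinned`), which cancels
(`equivalent_of_isPinned_kerPoly`). [folklore] -/
theorem betaCancellation_of_weightCompatible :
    ∀ (a b : ℚ) (A B : ℕ), a ≤ A + 1 → b ≤ B + 1 → ∀ (w : ℝ → ℝ),
    (∀ t, w t = if t ∈ Set.Ioo (0:ℝ) 1 then
      t ^ ((((A:ℚ) + 1 - a : ℚ)) : ℝ) * (1 - t) ^ ((((B:ℚ) + 1 - b : ℚ)) : ℝ) else 0) →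
    ∀ ⦃n m : ℕ⦄ (r : IntegralRep n) (r' : IntegralRep m) (q : IntegralRep (1 + n)) (q' : IntegralRep (1 + m)),
    q.domain = {z | z (Fin.castAdd n 0) ∈ Set.Ioo (0:ℝ) 1 ∧ (fun j => z (Fin.natAdd 1 j)) ∈ r.domain} →
    Set.EqOn q.integrand (fun z => (z (Fin.castAdd n 0)) ^ ((a:ℝ) - 1) *
      (1 - z (Fin.castAdd n 0)) ^ ((b:ℝ) - 1) * r.integrand (fun j => z (Fin.natAdd 1 j))) q.domain →
    q'.domain = {z | z (Fin.castAdd m 0) ∈ Set.Ioo (0:ℝ) 1 ∧ (fun j => z (Fin.natAdd 1 j)) ∈ r'.domain} →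
    Set.EqOn q'.integrand (fun z => (z (Fin.castAdd m 0)) ^ ((a:ℝ) - 1) *
      (1 - z (Fin.castAdd m 0)) ^ ((b:ℝ) - 1) * r'.integrand (fun j => z (Fin.natAdd 1 j))) q'.domain →
    of q - of q' ∈ AddSubgroup.closure (domainAddRel ∪ integrandAddRel ∪
          {x | ∃ (n : ℕ) (r r' : IntegralRep (n + 1)) (Φ : (Fin (n + 1) → ℝ) → (Fin (n + 1) → ℝ))
              (Φ' : (Fin (n + 1) → ℝ) → (Fin (n + 1) → ℝ) →L[ℝ] (Fin (n + 1) → ℝ)),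
            IsSemialgebraicMapOn ℚ r.domain Φ ∧
            (∀ x ∈ r.domain, HasFDerivWithinAt Φ (Φ' x) r.domain x) ∧ Set.InjOn Φ r.domain ∧
            r'.domain = Φ '' r.domain ∧
            (∀ x ∈ r.domain, r.integrand x = r'.integrand (Φ x) * |(Φ' x).det|) ∧
            (∀ x ∈ r.domain, w (Φ x 0) = w (x 0)) ∧
            x = of r - of r'} ∪
          fibredNewtonLeibnizRel) →
    Equivalent r r' := by
  intro a b A B haA hbB w hw n m r r' q q' hqd hqi hq'd hq'i hcert
  -- the weight is admissible
  have hα : (0:ℚ) ≤ (A:ℚ) + 1 - a := by linarith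
  have hβ : (0:ℚ) ≤ (B:ℚ) + 1 - b := by linarith
  obtain ⟨hsa0, hbd0⟩ := stub_betaWeightSemialgebraic ((A:ℚ) + 1 - a) ((B:ℚ) + 1 - b) hα hβ
  have hwfun : w = fun t => if t ∈ Set.Ioo (0:ℝ) 1 then
      t ^ ((((A:ℚ) + 1 - a : ℚ)) : ℝ) * (1 - t) ^ ((((B:ℚ) + 1 - b : ℚ)) : ℝ) else 0 := funext hw
  have hsa : IsSemialgebraicFunOn ℚ (Set.univ : Set (Fin 1 → ℝ)) (fun x => w (x 0)) := by
    rw [hwfun]; exact hsa0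
  have hbd : ∀ t : ℝ, |w t| ≤ 1 := fun t => by rw [hw t]; exact hbd0 t
  -- the multiplier
  have hex := stub_weightExists w hsa 1 hbd
  obtain ⟨M, h0, hpin⟩ := exists_weightMul w hex
  have hM : M (of q - of q') ∈ relations := stub_weightMul w hsa hex M h0 hpin _ hcert
  -- the weighted companions of `q`, `q'`, pinned with the integer kernel
  obtain ⟨s, hsd, hsi⟩ := weightExists_of_dim_eq w hex (Nat.add_comm 1 n) (Fin.castAdd n 0) rfl q
  obtain ⟨s', hs'd, hs'i⟩ := weightExists_of_dim_eq w hex (Nat.add_comm 1 m) (Fin.castAdd m 0) rfl q'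
  have hMq : M (of q) = of s :=
    weightMul_apply_of_dim_eq w M hpin (Nat.add_comm 1 n) (Fin.castAdd n 0) rfl q s hsd hsi
  have hMq' : M (of q') = of s' :=
    weightMul_apply_of_dim_eq w M hpin (Nat.add_comm 1 m) (Fin.castAdd m 0) rfl q' s' hs'd hs'i
  have hs : IsPinned (fun t => (Polynomial.aeval t (kerPoly A B) : ℝ)) r s :=
    stub_betaWeightPinned a b A B w hw r q s hqd hqi hsd hsi
  have hs' : IsPinned (fun t => (Polynomial.aeval t (kerPoly A B) : ℝ)) r' s' :=
    stub_betaWeightPinned a b A B w hw r' q' s' hq'd hq'i hs'd hs'i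
  have hss' : of s - of s' ∈ relations := by
    rw [← hMq, ← hMq', ← map_sub]; exact hM
  exact equivalent_of_isPinned_kerPoly A B hs hs' hss'

/-- **`BetaCancellation` FOR FIBRED CERTIFICATES — all positive rational exponents**: if `q ∼ q'`
by a chain of moves treating the Beta variable as a parameter (`KZ.fibredRelations`: additivity,
substitutions with `Φ z 0 = z 0`, Newton–Leibniz over bases of dimension `≥ 1`), then `r ∼ r'`.
(`A = ⌈a⌉ − 1`, `B = ⌈b⌉ − 1` always exist; a fibred substitution preserves every weight of `z 0`.)
[folklore] -/
theorem betaCancellation_of_fibredCertificate (a b : ℚ) (A B : ℕ)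
    (haA : a ≤ A + 1) (hbB : b ≤ B + 1)
    ⦃n m : ℕ⦄ (r : IntegralRep n) (r' : IntegralRep m) (q : IntegralRep (1 + n)) (q' : IntegralRep (1 + m))
    (hqd : q.domain = {z | z (Fin.castAdd n 0) ∈ Set.Ioo (0:ℝ) 1 ∧ (fun j => z (Fin.natAdd 1 j)) ∈ r.domain})
    (hqi : Set.EqOn q.integrand (fun z => (z (Fin.castAdd n 0)) ^ ((a:ℝ) - 1) *
      (1 - z (Fin.castAdd n 0)) ^ ((b:ℝ) - 1) * r.integrand (fun j => z (Fin.natAdd 1 j))) q.domain)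
    (hq'd : q'.domain = {z | z (Fin.castAdd m 0) ∈ Set.Ioo (0:ℝ) 1 ∧ (fun j => z (Fin.natAdd 1 j)) ∈ r'.domain})
    (hq'i : Set.EqOn q'.integrand (fun z => (z (Fin.castAdd m 0)) ^ ((a:ℝ) - 1) *
      (1 - z (Fin.castAdd m 0)) ^ ((b:ℝ) - 1) * r'.integrand (fun j => z (Fin.natAdd 1 j))) q'.domain)
    (hcert : of q - of q' ∈ fibredRelations) :
    Equivalent r r' := by
  set w : ℝ → ℝ := fun t => if t ∈ Set.Ioo (0:ℝ) 1 then
      t ^ ((((A:ℚ) + 1 - a : ℚ)) : ℝ) * (1 - t) ^ ((((B:ℚ) + 1 - b : ℚ)) : ℝ) else 0 with hw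
  refine betaCancellation_of_weightCompatible a b A B haA hbB w (fun t => by rw [hw]) r r' q q'
    hqd hqi hq'd hq'i ?_
  rw [fibredRelations_def] at hcert
  refine AddSubgroup.closure_mono ?_ hcert
  rw [fibredGenerators_def]
  rintro y (((hy | hy) | hy) | hy)
  · exact Or.inl (Or.inl (Or.inl hy))
  · exact Or.inl (Or.inl (Or.inr hy))
  · obtain ⟨k, ρ, ρ', Φ, Φ', hΦ, hΦ', hinj, hdom, hf, h0, rfl⟩ := hy
    exact Or.inl (Or.inr ⟨k, ρ, ρ', Φ, Φ', hΦ, hΦ', hinj, hdom, hf,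
      fun x hx => by rw [h0 x hx], rfl⟩)
  · exact Or.inr hy

end Summit.KontsevichZagierPeriods.KontsevichZagierPeriods.BetaCancellationLine
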